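import Literature.Analysis.FluidPDE.FluidComputer.EnergyParseval
import Literature.Analysis.FluidPDE.FluidComputer.ABCFlowData

/-!
# The classical lattice data in Fourier space: the Taylor–Green, Kida–Pelz (and, v2, ABC) data as `FourierVelocity` fields on their 8 / 24 / 6 modes

HONEST FRAMING (cell `pub-fluidc`, verbatim): *low prior, high value-of-information experiment on
Tao's machine paradigm; NOT a claim that NS blows up.* Nothing here concerns the Navier–Stokes
evolution beyond the Galerkin-truncated ODE system of `GalerkinEnergyBalance`.

`ClassicalLatticeData` holds the Taylor–Green datum `u = (sin x cos y cos z, -cos x sin y cos z, 0)`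
[cite: VanReesEtAl2011VortexSpectral, §3.1 eq. (10)] as a closed form on `ℝ³` and computes its
cell numbers `E(0) = 1/8`, `Z(0) = 3/8` by iterated integrals. Here the SAME datum is written as
what a pseudo-spectral engine holds — a real, incompressible Fourier coefficient field
(`ShellTransfer.FourierVelocity`) carried by the eight wavevectors `(±1, ±1, ±1)`:
`û(k) = (-i k₀/8, i k₁/8, 0)` (`TaylorGreenHat.tg`). PROVED:

* `TaylorGreenHat.field_eq_u/v/w`: the trigonometric polynomial of these coefficients IS the closed
  form (`ShellTransfer.field tg modes j = u, v, w` as complex numbers) [folklore: Euler's formula];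
* `tg_isSingleShell`: every carried mode has `|k|² = 3` (the atlas's `k0 = √3` pin);
* `truncEnergy_tg = 1/8`, `truncEnstrophy_tg = 3/8` by FINITE SUMS over the eight modes, and
  `truncEnergy_tg_eq_cellEnergy`: the spectral energy equals ClassicalLatticeData's cell-average
  energy BY PARSEVAL (`cellEnergy_field_eq_truncEnergy`) — two independent typed computations of
  the G1 sanity number agree;
* **`hasDerivAt_truncEnstrophy_tg`**: along ANY unforced Galerkin solution on a mode set
  `S ⊇ modes` that starts from the Taylor–Green datum, `dZ_S/dt (0) = -(9/4)ν` (`= -2ν·3·(3/8)`,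
  the single-shell identity of GalerkinEnergyBalance v3), in particular `0` for truncated Euler:
  the first-step check of both engines' G1 enstrophy curves (TGV Re = 1600: `-9/6400`).

And the same for KIDA–PELZ [cite: CichowlasBrachet2005, eq. (4)] (`KidaPelzHat.kp`: 24 modes
`(±1,±3,±1) ∪ (±1,±1,±3) ∪ (±3,±1,±1)`, `|k|² = 11`): `field_eq_u/v/w` (the trigonometric
polynomial IS `ClassicalLatticeData.KidaPelz.u/v/w`), `kp_isSingleShell` (`|k|² = 11`, the `k0 = √11`
pin), `truncEnergy_kp = 3/8`, `truncEnstrophy_kp = 33/8` by finite sums AND `= cellEnergy`,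
`= cellEnstrophy` by Parseval (an independent check of ClassicalLatticeData's 1000-line iterated-integral
computation), **`hasDerivAt_truncEnstrophy_kp`: `dZ_S/dt (0) = -(363/4)ν`** (`0` for Euler),
`hasDerivAt_truncEnergy_kp`: `dE_S/dt (0) = -(33/4)ν`.

v2 (same seat) — the ABC datum [cite: Frisch1995Turbulence, eq. (9.4)] (`ABCHat.abc p` for amplitudes
`p : ABCFlow.Coeffs`, six modes `±e₁, ±e₂, ±e₃`): `field_eq_u/v/w` (= `ABCFlowData`'s closed form),
**`curl_abc_coeff`: `ik × û(k) = û(k)`** (Beltrami in Fourier space), `abc_isSingleShell` (`|k|² = 1`),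
`truncEnergy_abc = (A²+B²+C²)/2`, `truncEnstrophy_abc = E_S`, `modalHelicity_abc` (`H(k) = 2E(k)`),
`truncHelicity_abc = A²+B²+C²`, the Parseval cross-checks `truncEnergy_abc_eq_cellEnergy`,
`truncHelicity_abc_eq_cellHelicity` (against ABCFlowData's iterated integrals), and
`modalHelicity_abc_eq_bound`: the realizability bound `|H(k)| ≤ 2|k|E(k)` of EnergyParseval v3 is an
EQUALITY on every ABC mode. No named facts (D-0026).
-/

noncomputable section

namespace Literature.Analysis.FluidPDE.FluidComputer

open Complex ComplexConjugate Finset Real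
open scoped BigOperators

namespace ShellTransfer

/-! ## Euler's formula in the `mode` vocabulary -/

/-- `cos t = (e_1(t) + e_{-1}(t))/2`. [folklore] -/
theorem ofReal_cos_eq_mode (t : ℝ) : ((Real.cos t : ℝ) : ℂ) = (mode 1 t + mode (-1) t) / 2 := by
  rw [Complex.ofReal_cos]
  unfold mode
  rw [Complex.cos]
  congr 1
  push_cast
  ring_nf

/-- `sin t = -(i/2)(e_1(t) - e_{-1}(t))`. [folklore] -/
theorem ofReal_sin_eq_mode (t : ℝ) : ((Real.sin t : ℝ) : ℂ) = -I / 2 * (mode 1 t - mode (-1) t) := by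
  rw [Complex.ofReal_sin]
  unfold mode
  rw [Complex.sin]
  push_cast
  ring_nf

/-! ## The mode set `{±1}³` as a product -/

/-- `{1, -1} ⊂ ℤ`. [folklore] -/
def pmOne : Finset ℤ := {1, -1}

/-- `Σ_{a∈{1,-1}} h a = h 1 + h (-1)`. [folklore] -/
theorem sum_pmOne {M : Type*} [AddCommMonoid M] (h : ℤ → M) : ∑ a ∈ pmOne, h a = h 1 + h (-1) :=
  Finset.sum_pair (by decide)

/-- `a ∈ {1,-1} ↔ a = 1 ∨ a = -1`. [folklore] -/
theorem mem_pmOne {a : ℤ} : a ∈ pmOne ↔ a = 1 ∨ a = -1 := by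
  unfold pmOne; simp

/-- `a ∈ {1,-1} → a² = 1` (in `ℂ`). [folklore] -/
theorem sq_eq_one_of_mem_pmOne {a : ℤ} (h : a ∈ pmOne) : ((a : ℂ)) ^ 2 = 1 := by
  rcases mem_pmOne.mp h with rfl | rfl <;> norm_num

/-- `a ∈ {1,-1} → a² = 1` (in `ℝ`). [folklore] -/
theorem sq_eq_one_of_mem_pmOne_real {a : ℤ} (h : a ∈ pmOne) : ((a : ℝ)) ^ 2 = 1 := by
  rcases mem_pmOne.mp h with rfl | rfl <;> norm_num

/-- `a ∈ {1,-1} → -a ∈ {1,-1}`. [folklore] -/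
theorem neg_mem_pmOne {a : ℤ} (h : a ∈ pmOne) : -a ∈ pmOne := by
  rcases mem_pmOne.mp h with rfl | rfl <;> decide

/-- The embedding `(a,b,c) ↦ (a,b,c)` of `ℤ × ℤ × ℤ` into `Fin 3 → ℤ`. [folklore] -/
def vec3 (t : ℤ × ℤ × ℤ) : Fin 3 → ℤ := ![t.1, t.2.1, t.2.2]

/-- `vec3 t 0 = t.1`. [folklore] -/
@[simp] theorem vec3_zero (t : ℤ × ℤ × ℤ) : vec3 t 0 = t.1 := rfl
/-- `vec3 t 1 = t.2.1`. [folklore] -/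
@[simp] theorem vec3_one (t : ℤ × ℤ × ℤ) : vec3 t 1 = t.2.1 := rfl
/-- `vec3 t 2 = t.2.2`. [folklore] -/
@[simp] theorem vec3_two (t : ℤ × ℤ × ℤ) : vec3 t 2 = t.2.2 := rfl

/-- `vec3` is injective. [folklore] -/
theorem vec3_injective : Function.Injective vec3 := by
  intro s t h
  have h0 := congrFun h 0
  have h1 := congrFun h 1
  have h2 := congrFun h 2
  simp only [vec3_zero, vec3_one, vec3_two] at h0 h1 h2
  exact Prod.ext h0 (Prod.ext h1 h2)

/-- Every `k : Fin 3 → ℤ` is `vec3 (k 0, k 1, k 2)`. [folklore] -/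
theorem vec3_eta (k : Fin 3 → ℤ) : vec3 (k 0, k 1, k 2) = k := by
  funext i
  fin_cases i <;> rfl

namespace TaylorGreenHat

/-- The eight wavevectors `(±1, ±1, ±1)` carrying the Taylor–Green datum. [folklore] -/
def modes : Finset (Fin 3 → ℤ) := (pmOne ×ˢ pmOne ×ˢ pmOne).image vec3

/-- Membership: all three entries are `±1`. [folklore] -/
theorem mem_modes {k : Fin 3 → ℤ} : k ∈ modes ↔ k 0 ∈ pmOne ∧ k 1 ∈ pmOne ∧ k 2 ∈ pmOne := by
  unfold modes
  rw [Finset.mem_image]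
  constructor
  · rintro ⟨t, ht, rfl⟩
    simp only [Finset.mem_product] at ht
    simpa using ht
  · rintro ⟨h0, h1, h2⟩
    exact ⟨(k 0, k 1, k 2), by simp [Finset.mem_product, h0, h1, h2], vec3_eta k⟩

/-- The mode set is symmetric under `k ↦ -k`. [folklore] -/
theorem neg_mem_modes {k : Fin 3 → ℤ} (h : k ∈ modes) : -k ∈ modes := by
  rw [mem_modes] at h ⊢
  simp only [Pi.neg_apply]
  exact ⟨neg_mem_pmOne h.1, neg_mem_pmOne h.2.1, neg_mem_pmOne h.2.2⟩

/-- Sums over the modes are iterated sums over `{±1}`. [folklore] -/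
theorem sum_modes {M : Type*} [AddCommMonoid M] (g : (Fin 3 → ℤ) → M) :
    ∑ k ∈ modes, g k = ∑ a ∈ pmOne, ∑ b ∈ pmOne, ∑ c ∈ pmOne, g ![a, b, c] := by
  unfold modes
  rw [Finset.sum_image fun s _ t _ h => vec3_injective h, Finset.sum_product]
  refine Finset.sum_congr rfl fun a _ => ?_
  rw [Finset.sum_product]
  rfl

/-- The Taylor–Green Fourier coefficients: `û(k) = (-i k₀/8, i k₁/8, 0)` on the modes, `0` elsewhere.
[folklore: Euler's formula applied to [cite: VanReesEtAl2011VortexSpectral, §3.1 eq. (10)]] -/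
def coeffFun (k : Fin 3 → ℤ) (j : Fin 3) : ℂ :=
  if k ∈ modes then ![-I * ((k 0 : ℤ) : ℂ) / 8, I * ((k 1 : ℤ) : ℂ) / 8, 0] j else 0

/-- **The Taylor–Green datum as a `FourierVelocity`** (real and divergence-free in Fourier space).
[folklore: Euler's formula applied to [cite: VanReesEtAl2011VortexSpectral, §3.1 eq. (10)]] -/
def tg : FourierVelocity where
  coeff := coeffFun
  reality k i := by
    unfold coeffFun
    by_cases hk : k ∈ modes
    · rw [if_pos (neg_mem_modes hk), if_pos hk]
      fin_cases i <;> simp [Pi.neg_apply, map_mul, map_div₀, Complex.conj_I, map_intCast, map_ofNat]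
    · have hnk : -k ∉ modes := fun h => hk (by simpa using neg_mem_modes h)
      rw [if_neg hnk, if_neg hk, map_zero]
  divFree k := by
    unfold coeffFun
    by_cases hk : k ∈ modes
    · obtain ⟨h0, h1, -⟩ := mem_modes.mp hk
      have e0 := sq_eq_one_of_mem_pmOne h0
      have e1 := sq_eq_one_of_mem_pmOne h1
      simp only [if_pos hk, Fin.sum_univ_three, Matrix.cons_val_zero, Matrix.cons_val_one,
        Matrix.head_cons, Matrix.cons_val_two, Matrix.tail_cons, mul_zero, add_zero]
      linear_combination (-I / 8) * e0 + (I / 8) * e1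
    · simp [if_neg hk]

/-- The coefficients on a carried mode. [folklore] -/
theorem coeff_of_mem {k : Fin 3 → ℤ} (hk : k ∈ modes) (j : Fin 3) :
    tg.coeff k j = ![-I * ((k 0 : ℤ) : ℂ) / 8, I * ((k 1 : ℤ) : ℂ) / 8, 0] j := by
  show coeffFun k j = _
  unfold coeffFun; rw [if_pos hk]

/-- and off the modes. [folklore] -/
theorem coeff_of_not_mem {k : Fin 3 → ℤ} (hk : k ∉ modes) : tg.coeff k = 0 := by
  funext j
  show coeffFun k j = 0
  unfold coeffFun; rw [if_neg hk]

/-- On a product triple of `±1`'s the mode is carried. [folklore] -/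
theorem vec_mem_modes {a b c : ℤ} (ha : a ∈ pmOne) (hb : b ∈ pmOne) (hc : c ∈ pmOne) :
    (![a, b, c] : Fin 3 → ℤ) ∈ modes :=
  mem_modes.mpr ⟨by simpa using ha, by simpa using hb, by simpa using hc⟩

/-! ## The trigonometric polynomial of `tg` is the Taylor–Green closed form -/

/-- `u`: `Σ_k û₀(k) e^{ik·x} = sin x cos y cos z`. [folklore] -/
theorem field_eq_u (x y z : ℝ) : field tg modes 0 x y z = ((TaylorGreen.u x y z : ℝ) : ℂ) := by
  unfold field TaylorGreen.u
  rw [sum_modes]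
  have h : ∀ a ∈ pmOne, ∀ b ∈ pmOne, ∀ c ∈ pmOne,
      tg.coeff ![a, b, c] 0 * wave ![a, b, c] x y z = (-I * (a : ℂ) / 8) * (mode a x * mode b y * mode c z) := by
    intro a ha b hb c hc
    rw [coeff_of_mem (vec_mem_modes ha hb hc)]
    rfl
  rw [Finset.sum_congr rfl fun a ha => Finset.sum_congr rfl fun b hb =>
    Finset.sum_congr rfl fun c hc => h a ha b hb c hc]
  simp only [sum_pmOne, Complex.ofReal_mul]
  rw [ofReal_sin_eq_mode, ofReal_cos_eq_mode, ofReal_cos_eq_mode]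
  push_cast
  ring

/-- `v`: `Σ_k û₁(k) e^{ik·x} = -cos x sin y cos z`. [folklore] -/
theorem field_eq_v (x y z : ℝ) : field tg modes 1 x y z = ((TaylorGreen.v x y z : ℝ) : ℂ) := by
  unfold field TaylorGreen.v
  rw [sum_modes]
  have h : ∀ a ∈ pmOne, ∀ b ∈ pmOne, ∀ c ∈ pmOne,
      tg.coeff ![a, b, c] 1 * wave ![a, b, c] x y z = (I * (b : ℂ) / 8) * (mode a x * mode b y * mode c z) := by
    intro a ha b hb c hc
    rw [coeff_of_mem (vec_mem_modes ha hb hc)]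
    rfl
  rw [Finset.sum_congr rfl fun a ha => Finset.sum_congr rfl fun b hb =>
    Finset.sum_congr rfl fun c hc => h a ha b hb c hc]
  simp only [sum_pmOne, Complex.ofReal_mul, Complex.ofReal_neg]
  rw [ofReal_sin_eq_mode, ofReal_cos_eq_mode, ofReal_cos_eq_mode]
  push_cast
  ring

/-- `w`: `Σ_k û₂(k) e^{ik·x} = 0`. [folklore] -/
theorem field_eq_w (x y z : ℝ) : field tg modes 2 x y z = ((TaylorGreen.w x y z : ℝ) : ℂ) := by
  unfold field TaylorGreen.w
  rw [sum_modes]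
  have h : ∀ a ∈ pmOne, ∀ b ∈ pmOne, ∀ c ∈ pmOne,
      tg.coeff ![a, b, c] 2 * wave ![a, b, c] x y z = 0 := by
    intro a ha b hb c hc
    rw [coeff_of_mem (vec_mem_modes ha hb hc)]
    simp
  rw [Finset.sum_congr rfl fun a ha => Finset.sum_congr rfl fun b hb =>
    Finset.sum_congr rfl fun c hc => h a ha b hb c hc]
  simp

/-! ## Single shell, energy `1/8`, enstrophy `3/8` -/

/-- Every carried mode has `|k|² = 3`. [folklore] -/
theorem tg_isSingleShell : IsSingleShell tg 3 := by
  intro k hk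
  by_cases hm : k ∈ modes
  · obtain ⟨h0, h1, h2⟩ := mem_modes.mp hm
    unfold knormSq
    rw [Fin.sum_univ_three, sq_eq_one_of_mem_pmOne_real h0, sq_eq_one_of_mem_pmOne_real h1,
      sq_eq_one_of_mem_pmOne_real h2]
    norm_num
  · exact absurd (coeff_of_not_mem hm) hk

/-- Each carried mode holds energy `E(k) = 1/64`. [folklore] -/
theorem modalEnergy_of_mem {k : Fin 3 → ℤ} (hk : k ∈ modes) : modalEnergy tg k = 1 / 64 := by
  obtain ⟨h0, h1, -⟩ := mem_modes.mp hk
  unfold modalEnergy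
  rw [Fin.sum_univ_three, coeff_of_mem hk, coeff_of_mem hk, coeff_of_mem hk]
  simp only [Matrix.cons_val_zero, Matrix.cons_val_one, Matrix.head_cons, Matrix.cons_val_two,
    Matrix.tail_cons, map_zero, add_zero, Complex.normSq_div, Complex.normSq_mul, Complex.normSq_neg,
    Complex.normSq_I, Complex.normSq_intCast]
  have e0 : ((k 0 : ℤ) : ℝ) * (k 0 : ℤ) = 1 := by
    have := sq_eq_one_of_mem_pmOne_real h0; rwa [sq] at this
  have e1 : ((k 1 : ℤ) : ℝ) * (k 1 : ℤ) = 1 := by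
    have := sq_eq_one_of_mem_pmOne_real h1; rwa [sq] at this
  have e8 : Complex.normSq (8 : ℂ) = 64 := by
    rw [show (8 : ℂ) = ((8 : ℝ) : ℂ) by norm_num, Complex.normSq_ofReal]; norm_num
  rw [e8, e0, e1]
  norm_num

/-- **`E_S = 1/8`** on the eight modes (`8 × 1/64`). [folklore] -/
theorem truncEnergy_tg : truncEnergy tg modes = 1 / 8 := by
  unfold truncEnergy
  rw [Finset.sum_congr rfl fun k hk => modalEnergy_of_mem hk, Finset.sum_const]
  have hcard : modes.card = 8 := by
    unfold modes
    rw [Finset.card_image_of_injective _ vec3_injective]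
    decide
  rw [hcard]
  norm_num

/-- **`Z_S = 3/8`** (`= 3 E_S`, single shell `|k|² = 3`). [folklore] -/
theorem truncEnstrophy_tg : truncEnstrophy tg modes = 3 / 8 := by
  rw [truncEnstrophy_eq_of_singleShell tg modes tg_isSingleShell, truncEnergy_tg]
  norm_num

/-- Off the eight modes the coefficients vanish, so `E_S`, `Z_S` on any larger mode set are the same.
[folklore] -/
theorem truncEnergy_tg_of_subset {S : Finset (Fin 3 → ℤ)} (hS : modes ⊆ S) :
    truncEnergy tg S = 1 / 8 := by
  rw [← truncEnergy_tg]
  unfold truncEnergy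
  symm
  refine Finset.sum_subset hS fun k _ hk => ?_
  exact modalEnergy_eq_zero_of_coeff tg (coeff_of_not_mem hk)

/-- `Z_S = 3/8` on any mode set containing the eight modes. [folklore] -/
theorem truncEnstrophy_tg_of_subset {S : Finset (Fin 3 → ℤ)} (hS : modes ⊆ S) :
    truncEnstrophy tg S = 3 / 8 := by
  rw [truncEnstrophy_eq_of_singleShell tg S tg_isSingleShell, truncEnergy_tg_of_subset hS]
  norm_num

/-- **Parseval cross-check**: the spectral energy of `tg` equals ClassicalLatticeData's cell-average
energy of the closed-form datum (both are `1/8`, here derived one from the other). [folklore] -/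
theorem truncEnergy_tg_eq_cellEnergy :
    truncEnergy tg modes = cellEnergy TaylorGreen.u TaylorGreen.v TaylorGreen.w := by
  rw [← cellEnergy_field_eq_truncEnergy tg modes fun k hk => neg_mem_modes hk]
  congr 1 <;> funext x y z
  · rw [field_eq_u, Complex.ofReal_re]
  · rw [field_eq_v, Complex.ofReal_re]
  · rw [field_eq_w, Complex.ofReal_re]

/-- and the spectral enstrophy equals the cell enstrophy `½⟨|ω|²⟩` of the closed form. [folklore] -/
theorem truncEnstrophy_tg_eq_cellEnstrophy :
    truncEnstrophy tg modes = cellEnstrophy TaylorGreen.u TaylorGreen.v TaylorGreen.w := by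
  rw [← cellEnstrophy_field_eq_truncEnstrophy tg modes fun k hk => neg_mem_modes hk]
  congr 1 <;> funext x y z
  · rw [field_eq_u, Complex.ofReal_re]
  · rw [field_eq_v, Complex.ofReal_re]
  · rw [field_eq_w, Complex.ofReal_re]

/-! ## The initial enstrophy slope of the Taylor–Green Galerkin evolution -/

/-- **`dZ_S/dt (0) = -(9/4)ν` from the Taylor–Green datum**, along any unforced Galerkin solution
on a mode set containing the eight modes (`-2ν·3·(3/8)`; `0` for truncated Euler). [folklore] -/
theorem hasDerivAt_truncEnstrophy_tg {U : ℝ → FourierVelocity} {S : Finset (Fin 3 → ℤ)} {ν : ℝ}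
    {c : ℝ → (Fin 3 → ℤ) → ℂ} (hU : IsGalerkinSolution U S ν c fun _ _ _ => 0) (h0 : U 0 = tg)
    (hS : modes ⊆ S) :
    HasDerivAt (fun s => truncEnstrophy (U s) S) (-(9 / 4) * ν) 0 := by
  have h := hasDerivAt_truncEnstrophy_singleShell hU 0 (lam := 3) (by rw [h0]; exact tg_isSingleShell)
  rw [h0, truncEnstrophy_tg_of_subset hS] at h
  convert h using 1
  ring

/-- The truncated-Euler case: the Taylor–Green enstrophy curve starts flat. [folklore] -/
theorem hasDerivAt_truncEnstrophy_tg_euler {U : ℝ → FourierVelocity} {S : Finset (Fin 3 → ℤ)}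
    {c : ℝ → (Fin 3 → ℤ) → ℂ} (hU : IsGalerkinSolution U S 0 c fun _ _ _ => 0) (h0 : U 0 = tg)
    (hS : modes ⊆ S) :
    HasDerivAt (fun s => truncEnstrophy (U s) S) 0 0 := by
  simpa using hasDerivAt_truncEnstrophy_tg hU h0 hS

/-- and the energy slope `dE_S/dt (0) = -2ν Z_S(0) = -(3/4)ν`. [folklore] -/
theorem hasDerivAt_truncEnergy_tg {U : ℝ → FourierVelocity} {S : Finset (Fin 3 → ℤ)} {ν : ℝ}
    {c : ℝ → (Fin 3 → ℤ) → ℂ} (hU : IsGalerkinSolution U S ν c fun _ _ _ => 0) (h0 : U 0 = tg)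
    (hS : modes ⊆ S) :
    HasDerivAt (fun s => truncEnergy (U s) S) (-(3 / 4) * ν) 0 := by
  have h := hasDerivAt_truncEnergy_galerkin hU 0
  rw [injectionRate_zero, add_zero, h0, truncEnstrophy_tg_of_subset hS] at h
  convert h using 1
  ring

end TaylorGreenHat

/-! ## Kida–Pelz: the 24 modes `(±1,±3,±1) ∪ (±1,±1,±3) ∪ (±3,±1,±1)`, `|k|² = 11`

`u = sin x (cos 3y cos z − cos y cos 3z)`, `v(x,y,z) = u(y,z,x)`, `w(x,y,z) = u(z,x,y)`
[cite: CichowlasBrachet2005, eq. (4)] (as in `ClassicalLatticeData.KidaPelz`). Euler's formula gives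
`û = (−ik₀/8, 0, ik₂/8)` on `M₁ = {±1}×{±3}×{±1}`, `(ik₀/8, −ik₁/8, 0)` on `M₂ = {±1}×{±1}×{±3}`,
`(0, ik₁/8, −ik₂/8)` on `M₃ = {±3}×{±1}×{±1}`; each mode carries `E(k) = 1/64`, so `E_S = 24/64 = 3/8`
and `Z_S = 11·3/8 = 33/8` — the numbers ClassicalLatticeData obtains by iterated integrals. -/

/-- `{3, -3} ⊂ ℤ`. [folklore] -/
def pmThree : Finset ℤ := {3, -3}

/-- `Σ_{a∈{3,-3}} h a = h 3 + h (-3)`. [folklore] -/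
theorem sum_pmThree {M : Type*} [AddCommMonoid M] (h : ℤ → M) : ∑ a ∈ pmThree, h a = h 3 + h (-3) :=
  Finset.sum_pair (by decide)

/-- `a ∈ {3,-3} ↔ a = 3 ∨ a = -3`. [folklore] -/
theorem mem_pmThree {a : ℤ} : a ∈ pmThree ↔ a = 3 ∨ a = -3 := by
  unfold pmThree; simp

/-- `a ∈ {3,-3} → a² = 9` (in `ℝ`). [folklore] -/
theorem sq_eq_nine_of_mem_pmThree_real {a : ℤ} (h : a ∈ pmThree) : ((a : ℝ)) ^ 2 = 9 := by
  rcases mem_pmThree.mp h with rfl | rfl <;> norm_num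

/-- `a ∈ {3,-3} → -a ∈ {3,-3}`. [folklore] -/
theorem neg_mem_pmThree {a : ℤ} (h : a ∈ pmThree) : -a ∈ pmThree := by
  rcases mem_pmThree.mp h with rfl | rfl <;> decide

/-- `{1,-1}` and `{3,-3}` are disjoint. [folklore] -/
theorem not_mem_pmThree_of_mem_pmOne {a : ℤ} (h : a ∈ pmOne) : a ∉ pmThree := by
  rcases mem_pmOne.mp h with rfl | rfl <;> decide

/-- `cos 3t = (e_3(t) + e_{-3}(t))/2`. [folklore] -/
theorem ofReal_cos_three_eq_mode (t : ℝ) :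
    ((Real.cos (3 * t) : ℝ) : ℂ) = (mode 3 t + mode (-3) t) / 2 := by
  rw [Complex.ofReal_cos]
  unfold mode
  rw [Complex.cos]
  congr 1
  push_cast
  ring_nf

namespace KidaPelzHat

/-- A product box `A × B × C ⊂ ℤ³` as a set of wavevectors. [folklore] -/
def box (A B C : Finset ℤ) : Finset (Fin 3 → ℤ) := (A ×ˢ B ×ˢ C).image vec3

/-- Membership in a box is entrywise. [folklore] -/
theorem mem_box {A B C : Finset ℤ} {k : Fin 3 → ℤ} : k ∈ box A B C ↔ k 0 ∈ A ∧ k 1 ∈ B ∧ k 2 ∈ C := by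
  unfold box
  rw [Finset.mem_image]
  constructor
  · rintro ⟨t, ht, rfl⟩
    simp only [Finset.mem_product] at ht
    simpa using ht
  · rintro ⟨h0, h1, h2⟩
    exact ⟨(k 0, k 1, k 2), by simp [Finset.mem_product, h0, h1, h2], vec3_eta k⟩

/-- Sums over a box are iterated sums. [folklore] -/
theorem sum_box {M : Type*} [AddCommMonoid M] (A B C : Finset ℤ) (g : (Fin 3 → ℤ) → M) :
    ∑ k ∈ box A B C, g k = ∑ a ∈ A, ∑ b ∈ B, ∑ c ∈ C, g ![a, b, c] := by
  unfold box
  rw [Finset.sum_image fun s _ t _ h => vec3_injective h, Finset.sum_product]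
  refine Finset.sum_congr rfl fun a _ => ?_
  rw [Finset.sum_product]
  rfl

/-- `M₁ = {±1}×{±3}×{±1}`. [folklore] -/
def M1 : Finset (Fin 3 → ℤ) := box pmOne pmThree pmOne
/-- `M₂ = {±1}×{±1}×{±3}`. [folklore] -/
def M2 : Finset (Fin 3 → ℤ) := box pmOne pmOne pmThree
/-- `M₃ = {±3}×{±1}×{±1}`. [folklore] -/
def M3 : Finset (Fin 3 → ℤ) := box pmThree pmOne pmOne

/-- The 24 Kida–Pelz modes. [folklore] -/
def modes : Finset (Fin 3 → ℤ) := M1 ∪ M2 ∪ M3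

/-- `M₁ ∩ M₂ = ∅` (second entry `±3` vs `±1`). [folklore] -/
theorem disjoint_M1_M2 : Disjoint M1 M2 := by
  rw [Finset.disjoint_left]
  intro k h1 h2
  rw [M1, mem_box] at h1; rw [M2, mem_box] at h2
  exact not_mem_pmThree_of_mem_pmOne h2.2.1 h1.2.1

/-- `M₁ ∩ M₃ = ∅`. [folklore] -/
theorem disjoint_M1_M3 : Disjoint M1 M3 := by
  rw [Finset.disjoint_left]
  intro k h1 h3
  rw [M1, mem_box] at h1; rw [M3, mem_box] at h3
  exact not_mem_pmThree_of_mem_pmOne h1.1 h3.1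

/-- `M₂ ∩ M₃ = ∅`. [folklore] -/
theorem disjoint_M2_M3 : Disjoint M2 M3 := by
  rw [Finset.disjoint_left]
  intro k h2 h3
  rw [M2, mem_box] at h2; rw [M3, mem_box] at h3
  exact not_mem_pmThree_of_mem_pmOne h2.1 h3.1

/-- hence `k ∈ M₂ → k ∉ M₁`. [folklore] -/
theorem not_mem_M1_of_mem_M2 {k : Fin 3 → ℤ} (h : k ∈ M2) : k ∉ M1 :=
  fun h1 => Finset.disjoint_left.mp disjoint_M1_M2 h1 h
/-- `k ∈ M₃ → k ∉ M₁`. [folklore] -/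
theorem not_mem_M1_of_mem_M3 {k : Fin 3 → ℤ} (h : k ∈ M3) : k ∉ M1 :=
  fun h1 => Finset.disjoint_left.mp disjoint_M1_M3 h1 h
/-- `k ∈ M₃ → k ∉ M₂`. [folklore] -/
theorem not_mem_M2_of_mem_M3 {k : Fin 3 → ℤ} (h : k ∈ M3) : k ∉ M2 :=
  fun h2 => Finset.disjoint_left.mp disjoint_M2_M3 h2 h

/-- Sums over the 24 modes split into the three boxes. [folklore] -/
theorem sum_modes {M : Type*} [AddCommMonoid M] (g : (Fin 3 → ℤ) → M) :
    ∑ k ∈ modes, g k = ∑ k ∈ M1, g k + ∑ k ∈ M2, g k + ∑ k ∈ M3, g k := by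
  unfold modes
  rw [Finset.sum_union, Finset.sum_union disjoint_M1_M2]
  rw [Finset.disjoint_union_left]
  exact ⟨disjoint_M1_M3, disjoint_M2_M3⟩

/-- Each box is symmetric under `k ↦ -k`. [folklore] -/
theorem neg_mem_M1 {k : Fin 3 → ℤ} (h : k ∈ M1) : -k ∈ M1 := by
  rw [M1, mem_box] at h ⊢; simp only [Pi.neg_apply]
  exact ⟨neg_mem_pmOne h.1, neg_mem_pmThree h.2.1, neg_mem_pmOne h.2.2⟩
/-- `M₂ = -M₂`. [folklore] -/
theorem neg_mem_M2 {k : Fin 3 → ℤ} (h : k ∈ M2) : -k ∈ M2 := by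
  rw [M2, mem_box] at h ⊢; simp only [Pi.neg_apply]
  exact ⟨neg_mem_pmOne h.1, neg_mem_pmOne h.2.1, neg_mem_pmThree h.2.2⟩
/-- `M₃ = -M₃`. [folklore] -/
theorem neg_mem_M3 {k : Fin 3 → ℤ} (h : k ∈ M3) : -k ∈ M3 := by
  rw [M3, mem_box] at h ⊢; simp only [Pi.neg_apply]
  exact ⟨neg_mem_pmThree h.1, neg_mem_pmOne h.2.1, neg_mem_pmOne h.2.2⟩

/-- The 24 modes are symmetric under `k ↦ -k`. [folklore] -/
theorem neg_mem_modes {k : Fin 3 → ℤ} (h : k ∈ modes) : -k ∈ modes := by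
  unfold modes at h ⊢
  rcases Finset.mem_union.mp h with h12 | h3
  · rcases Finset.mem_union.mp h12 with h1 | h2
    · exact Finset.mem_union_left _ (Finset.mem_union_left _ (neg_mem_M1 h1))
    · exact Finset.mem_union_left _ (Finset.mem_union_right _ (neg_mem_M2 h2))
  · exact Finset.mem_union_right _ (neg_mem_M3 h3)

/-- The Kida–Pelz Fourier coefficients (see the section docstring). [folklore: Euler's formula
applied to [cite: CichowlasBrachet2005, eq. (4)]] -/
def coeffFun (k : Fin 3 → ℤ) (j : Fin 3) : ℂ :=
  if k ∈ M1 then ![-I * ((k 0 : ℤ) : ℂ) / 8, 0, I * ((k 2 : ℤ) : ℂ) / 8] j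
  else if k ∈ M2 then ![I * ((k 0 : ℤ) : ℂ) / 8, -I * ((k 1 : ℤ) : ℂ) / 8, 0] j
  else if k ∈ M3 then ![0, I * ((k 1 : ℤ) : ℂ) / 8, -I * ((k 2 : ℤ) : ℂ) / 8] j
  else 0

/-- Coefficients on `M₁`. [folklore] -/
theorem coeffFun_of_M1 {k : Fin 3 → ℤ} (h : k ∈ M1) (j : Fin 3) :
    coeffFun k j = ![-I * ((k 0 : ℤ) : ℂ) / 8, 0, I * ((k 2 : ℤ) : ℂ) / 8] j := by
  unfold coeffFun; rw [if_pos h]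
/-- Coefficients on `M₂`. [folklore] -/
theorem coeffFun_of_M2 {k : Fin 3 → ℤ} (h : k ∈ M2) (j : Fin 3) :
    coeffFun k j = ![I * ((k 0 : ℤ) : ℂ) / 8, -I * ((k 1 : ℤ) : ℂ) / 8, 0] j := by
  unfold coeffFun; rw [if_neg (not_mem_M1_of_mem_M2 h), if_pos h]
/-- Coefficients on `M₃`. [folklore] -/
theorem coeffFun_of_M3 {k : Fin 3 → ℤ} (h : k ∈ M3) (j : Fin 3) :
    coeffFun k j = ![0, I * ((k 1 : ℤ) : ℂ) / 8, -I * ((k 2 : ℤ) : ℂ) / 8] j := by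
  unfold coeffFun; rw [if_neg (not_mem_M1_of_mem_M3 h), if_neg (not_mem_M2_of_mem_M3 h), if_pos h]
/-- Coefficients vanish off the 24 modes. [folklore] -/
theorem coeffFun_of_not_mem {k : Fin 3 → ℤ} (h : k ∉ modes) (j : Fin 3) : coeffFun k j = 0 := by
  unfold modes at h
  simp only [Finset.mem_union, not_or] at h
  unfold coeffFun; rw [if_neg h.1.1, if_neg h.1.2, if_neg h.2]

/-- **The Kida–Pelz datum as a `FourierVelocity`.** [folklore: Euler's formula applied to
[cite: CichowlasBrachet2005, eq. (4)]] -/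
def kp : FourierVelocity where
  coeff := coeffFun
  reality k i := by
    by_cases h1 : k ∈ M1
    · rw [coeffFun_of_M1 (neg_mem_M1 h1), coeffFun_of_M1 h1]
      fin_cases i <;> simp [Pi.neg_apply, map_mul, map_div₀, Complex.conj_I, map_intCast, map_ofNat]
    by_cases h2 : k ∈ M2
    · rw [coeffFun_of_M2 (neg_mem_M2 h2), coeffFun_of_M2 h2]
      fin_cases i <;> simp [Pi.neg_apply, map_mul, map_div₀, Complex.conj_I, map_intCast, map_ofNat]
    by_cases h3 : k ∈ M3
    · rw [coeffFun_of_M3 (neg_mem_M3 h3), coeffFun_of_M3 h3]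
      fin_cases i <;> simp [Pi.neg_apply, map_mul, map_div₀, Complex.conj_I, map_intCast, map_ofNat]
    have hk : k ∉ modes := by
      unfold modes; simp only [Finset.mem_union, not_or]; exact ⟨⟨h1, h2⟩, h3⟩
    have hnk : -k ∉ modes := fun h => hk (by simpa using neg_mem_modes h)
    rw [coeffFun_of_not_mem hnk, coeffFun_of_not_mem hk, map_zero]
  divFree k := by
    by_cases h1 : k ∈ M1
    · obtain ⟨h0, -, h2⟩ := (mem_box.mp h1 : _)
      have e0 := sq_eq_one_of_mem_pmOne h0
      have e2 := sq_eq_one_of_mem_pmOne h2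
      simp only [coeffFun_of_M1 h1, Fin.sum_univ_three, Matrix.cons_val_zero, Matrix.cons_val_one,
        Matrix.head_cons, Matrix.cons_val_two, Matrix.tail_cons, mul_zero, add_zero]
      linear_combination (-I / 8) * e0 + (I / 8) * e2
    by_cases h2 : k ∈ M2
    · obtain ⟨h0, h1', -⟩ := (mem_box.mp h2 : _)
      have e0 := sq_eq_one_of_mem_pmOne h0
      have e1 := sq_eq_one_of_mem_pmOne h1'
      simp only [coeffFun_of_M2 h2, Fin.sum_univ_three, Matrix.cons_val_zero, Matrix.cons_val_one,
        Matrix.head_cons, Matrix.cons_val_two, Matrix.tail_cons, mul_zero, add_zero]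
      linear_combination (I / 8) * e0 + (-I / 8) * e1
    by_cases h3 : k ∈ M3
    · obtain ⟨-, h1', h2'⟩ := (mem_box.mp h3 : _)
      have e1 := sq_eq_one_of_mem_pmOne h1'
      have e2 := sq_eq_one_of_mem_pmOne h2'
      simp only [coeffFun_of_M3 h3, Fin.sum_univ_three, Matrix.cons_val_zero, Matrix.cons_val_one,
        Matrix.head_cons, Matrix.cons_val_two, Matrix.tail_cons, mul_zero, zero_add]
      linear_combination (I / 8) * e1 + (-I / 8) * e2
    have hk : k ∉ modes := by
      unfold modes; simp only [Finset.mem_union, not_or]; exact ⟨⟨h1, h2⟩, h3⟩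
    simp [coeffFun_of_not_mem hk]

/-- `kp.coeff = coeffFun`. [folklore] -/
theorem kp_coeff (k : Fin 3 → ℤ) (j : Fin 3) : kp.coeff k j = coeffFun k j := rfl

/-! ### The trigonometric polynomial of `kp` is the Kida–Pelz closed form -/

/-- The three box sums of `coeffFun · j * wave`, evaluated. [folklore] -/
theorem sum_M1 (j : Fin 3) (x y z : ℝ) :
    ∑ k ∈ M1, coeffFun k j * wave k x y z = ∑ a ∈ pmOne, ∑ b ∈ pmThree, ∑ c ∈ pmOne,
      ![-I * (a : ℂ) / 8, 0, I * (c : ℂ) / 8] j * (mode a x * mode b y * mode c z) := by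
  rw [M1, sum_box]
  refine Finset.sum_congr rfl fun a ha => Finset.sum_congr rfl fun b hb =>
    Finset.sum_congr rfl fun c hc => ?_
  rw [coeffFun_of_M1 (mem_box.mpr ⟨by simpa using ha, by simpa using hb, by simpa using hc⟩)]
  rfl

/-- The `M₂` box sum, evaluated. [folklore] -/
theorem sum_M2 (j : Fin 3) (x y z : ℝ) :
    ∑ k ∈ M2, coeffFun k j * wave k x y z = ∑ a ∈ pmOne, ∑ b ∈ pmOne, ∑ c ∈ pmThree,
      ![I * (a : ℂ) / 8, -I * (b : ℂ) / 8, 0] j * (mode a x * mode b y * mode c z) := by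
  rw [M2, sum_box]
  refine Finset.sum_congr rfl fun a ha => Finset.sum_congr rfl fun b hb =>
    Finset.sum_congr rfl fun c hc => ?_
  rw [coeffFun_of_M2 (mem_box.mpr ⟨by simpa using ha, by simpa using hb, by simpa using hc⟩)]
  rfl

/-- The `M₃` box sum, evaluated. [folklore] -/
theorem sum_M3 (j : Fin 3) (x y z : ℝ) :
    ∑ k ∈ M3, coeffFun k j * wave k x y z = ∑ a ∈ pmThree, ∑ b ∈ pmOne, ∑ c ∈ pmOne,
      ![0, I * (b : ℂ) / 8, -I * (c : ℂ) / 8] j * (mode a x * mode b y * mode c z) := by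
  rw [M3, sum_box]
  refine Finset.sum_congr rfl fun a ha => Finset.sum_congr rfl fun b hb =>
    Finset.sum_congr rfl fun c hc => ?_
  rw [coeffFun_of_M3 (mem_box.mpr ⟨by simpa using ha, by simpa using hb, by simpa using hc⟩)]
  rfl

/-- `u`: `Σ_k û₀(k) e^{ik·x} = sin x (cos 3y cos z − cos y cos 3z)`. [folklore] -/
theorem field_eq_u (x y z : ℝ) : field kp modes 0 x y z = ((KidaPelz.u x y z : ℝ) : ℂ) := by
  unfold field KidaPelz.u
  simp only [kp_coeff]
  rw [sum_modes, sum_M1, sum_M2, sum_M3]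
  simp only [sum_pmOne, sum_pmThree, Matrix.cons_val_zero, Complex.ofReal_mul, Complex.ofReal_sub]
  rw [ofReal_cos_three_eq_mode, ofReal_cos_three_eq_mode, ofReal_sin_eq_mode, ofReal_cos_eq_mode,
    ofReal_cos_eq_mode]
  push_cast
  ring

/-- `v`: `Σ_k û₁(k) e^{ik·x} = sin y (cos 3z cos x − cos z cos 3x)`. [folklore] -/
theorem field_eq_v (x y z : ℝ) : field kp modes 1 x y z = ((KidaPelz.v x y z : ℝ) : ℂ) := by
  unfold field
  rw [KidaPelz.v_eq]
  simp only [kp_coeff]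
  rw [sum_modes, sum_M1, sum_M2, sum_M3]
  simp only [sum_pmOne, sum_pmThree, Matrix.cons_val_one, Matrix.cons_val_zero, Complex.ofReal_mul,
    Complex.ofReal_sub]
  rw [ofReal_cos_three_eq_mode, ofReal_cos_three_eq_mode, ofReal_sin_eq_mode, ofReal_cos_eq_mode,
    ofReal_cos_eq_mode]
  push_cast
  ring

/-- `w`: `Σ_k û₂(k) e^{ik·x} = sin z (cos 3x cos y − cos x cos 3y)`. [folklore] -/
theorem field_eq_w (x y z : ℝ) : field kp modes 2 x y z = ((KidaPelz.w x y z : ℝ) : ℂ) := by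
  unfold field
  rw [KidaPelz.w_eq]
  simp only [kp_coeff]
  rw [sum_modes, sum_M1, sum_M2, sum_M3]
  simp only [sum_pmOne, sum_pmThree, Matrix.cons_val_two, Matrix.tail_cons, Matrix.head_cons,
    Complex.ofReal_mul, Complex.ofReal_sub]
  rw [ofReal_cos_three_eq_mode, ofReal_cos_three_eq_mode, ofReal_sin_eq_mode, ofReal_cos_eq_mode,
    ofReal_cos_eq_mode]
  push_cast
  ring

/-! ### Single shell `|k|² = 11`, energy `3/8`, enstrophy `33/8` -/

/-- Every carried mode has `|k|² = 11`. [folklore] -/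
theorem kp_isSingleShell : IsSingleShell kp 11 := by
  intro k hk
  have hm : k ∈ modes := by
    by_contra h
    exact hk (funext fun j => coeffFun_of_not_mem h j)
  unfold modes at hm
  unfold knormSq
  rw [Fin.sum_univ_three]
  rcases Finset.mem_union.mp hm with h12 | h3
  · rcases Finset.mem_union.mp h12 with h1 | h2
    · obtain ⟨h0, h1', h2'⟩ := (mem_box.mp h1 : _)
      rw [sq_eq_one_of_mem_pmOne_real h0, sq_eq_nine_of_mem_pmThree_real h1',
        sq_eq_one_of_mem_pmOne_real h2']; norm_num
    · obtain ⟨h0, h1', h2'⟩ := (mem_box.mp h2 : _)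
      rw [sq_eq_one_of_mem_pmOne_real h0, sq_eq_one_of_mem_pmOne_real h1',
        sq_eq_nine_of_mem_pmThree_real h2']; norm_num
  · obtain ⟨h0, h1', h2'⟩ := (mem_box.mp h3 : _)
    rw [sq_eq_nine_of_mem_pmThree_real h0, sq_eq_one_of_mem_pmOne_real h1',
      sq_eq_one_of_mem_pmOne_real h2']; norm_num

/-- `normSq (±i a/8) = 1/64` for `a = ±1`, the per-component energy bookkeeping. [folklore] -/
theorem normSq_coeff_aux {a : ℤ} (ha : a ∈ pmOne) (s : ℂ) (hs : s = I ∨ s = -I) :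
    Complex.normSq (s * (a : ℂ) / 8) = 1 / 64 := by
  have e8 : Complex.normSq (8 : ℂ) = 64 := by
    rw [show (8 : ℂ) = ((8 : ℝ) : ℂ) by norm_num, Complex.normSq_ofReal]; norm_num
  have es : Complex.normSq s = 1 := by
    rcases hs with rfl | rfl
    · exact Complex.normSq_I
    · rw [Complex.normSq_neg, Complex.normSq_I]
  have ea : ((a : ℤ) : ℝ) * (a : ℤ) = 1 := by
    have := sq_eq_one_of_mem_pmOne_real ha; rwa [sq] at this
  rw [Complex.normSq_div, Complex.normSq_mul, es, Complex.normSq_intCast, e8, ea]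
  norm_num

/-- Each carried mode holds energy `E(k) = 1/64`. [folklore] -/
theorem modalEnergy_of_mem {k : Fin 3 → ℤ} (hk : k ∈ modes) : modalEnergy kp k = 1 / 64 := by
  unfold modalEnergy
  rw [Fin.sum_univ_three, kp_coeff, kp_coeff, kp_coeff]
  unfold modes at hk
  rcases Finset.mem_union.mp hk with h12 | h3
  · rcases Finset.mem_union.mp h12 with h1 | h2
    · obtain ⟨h0, -, h2'⟩ := (mem_box.mp h1 : _)
      rw [coeffFun_of_M1 h1, coeffFun_of_M1 h1, coeffFun_of_M1 h1]
      simp only [Matrix.cons_val_zero, Matrix.cons_val_one, Matrix.head_cons, Matrix.cons_val_two,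
        Matrix.tail_cons, map_zero, add_zero, neg_mul]
      rw [← neg_mul, normSq_coeff_aux h0 (-I) (Or.inr rfl), normSq_coeff_aux h2' I (Or.inl rfl)]
      norm_num
    · obtain ⟨h0, h1', -⟩ := (mem_box.mp h2 : _)
      rw [coeffFun_of_M2 h2, coeffFun_of_M2 h2, coeffFun_of_M2 h2]
      simp only [Matrix.cons_val_zero, Matrix.cons_val_one, Matrix.head_cons, Matrix.cons_val_two,
        Matrix.tail_cons, map_zero, add_zero, neg_mul]
      rw [← neg_mul, normSq_coeff_aux h0 I (Or.inl rfl), normSq_coeff_aux h1' (-I) (Or.inr rfl)]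
      norm_num
  · obtain ⟨-, h1', h2'⟩ := (mem_box.mp h3 : _)
    rw [coeffFun_of_M3 h3, coeffFun_of_M3 h3, coeffFun_of_M3 h3]
    simp only [Matrix.cons_val_zero, Matrix.cons_val_one, Matrix.head_cons, Matrix.cons_val_two,
      Matrix.tail_cons, map_zero, zero_add, neg_mul]
    rw [← neg_mul, normSq_coeff_aux h1' I (Or.inl rfl), normSq_coeff_aux h2' (-I) (Or.inr rfl)]
    norm_num

/-- The three boxes have 8 elements each; the mode set has 24. [folklore] -/
theorem card_modes : modes.card = 24 := by
  unfold modes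
  rw [Finset.card_union_of_disjoint (Finset.disjoint_union_left.mpr ⟨disjoint_M1_M3, disjoint_M2_M3⟩),
    Finset.card_union_of_disjoint disjoint_M1_M2]
  unfold M1 M2 M3 box
  rw [Finset.card_image_of_injective _ vec3_injective, Finset.card_image_of_injective _ vec3_injective,
    Finset.card_image_of_injective _ vec3_injective]
  decide

/-- **`E_S = 3/8`** on the 24 modes (`24 × 1/64`). [folklore] -/
theorem truncEnergy_kp : truncEnergy kp modes = 3 / 8 := by
  unfold truncEnergy
  rw [Finset.sum_congr rfl fun k hk => modalEnergy_of_mem hk, Finset.sum_const, card_modes]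
  norm_num

/-- **`Z_S = 33/8`** (`= 11 E_S`). [folklore] -/
theorem truncEnstrophy_kp : truncEnstrophy kp modes = 33 / 8 := by
  rw [truncEnstrophy_eq_of_singleShell kp modes kp_isSingleShell, truncEnergy_kp]
  norm_num

/-- `E_S = 3/8` on any mode set containing the 24 modes. [folklore] -/
theorem truncEnergy_kp_of_subset {S : Finset (Fin 3 → ℤ)} (hS : modes ⊆ S) :
    truncEnergy kp S = 3 / 8 := by
  rw [← truncEnergy_kp]
  unfold truncEnergy
  symm
  refine Finset.sum_subset hS fun k _ hk => ?_
  exact modalEnergy_eq_zero_of_coeff kp (funext fun j => coeffFun_of_not_mem hk j)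

/-- `Z_S = 33/8` on any mode set containing the 24 modes. [folklore] -/
theorem truncEnstrophy_kp_of_subset {S : Finset (Fin 3 → ℤ)} (hS : modes ⊆ S) :
    truncEnstrophy kp S = 33 / 8 := by
  rw [truncEnstrophy_eq_of_singleShell kp S kp_isSingleShell, truncEnergy_kp_of_subset hS]
  norm_num

/-- **Parseval cross-check** with ClassicalLatticeData's iterated-integral value `E(0) = 3/8`. [folklore] -/
theorem truncEnergy_kp_eq_cellEnergy :
    truncEnergy kp modes = cellEnergy KidaPelz.u KidaPelz.v KidaPelz.w := by
  rw [← cellEnergy_field_eq_truncEnergy kp modes fun k hk => neg_mem_modes hk]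
  congr 1 <;> funext x y z
  · rw [field_eq_u, Complex.ofReal_re]
  · rw [field_eq_v, Complex.ofReal_re]
  · rw [field_eq_w, Complex.ofReal_re]

/-- and with `Z(0) = 33/8`. [folklore] -/
theorem truncEnstrophy_kp_eq_cellEnstrophy :
    truncEnstrophy kp modes = cellEnstrophy KidaPelz.u KidaPelz.v KidaPelz.w := by
  rw [← cellEnstrophy_field_eq_truncEnstrophy kp modes fun k hk => neg_mem_modes hk]
  congr 1 <;> funext x y z
  · rw [field_eq_u, Complex.ofReal_re]
  · rw [field_eq_v, Complex.ofReal_re]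
  · rw [field_eq_w, Complex.ofReal_re]

/-! ### The initial slopes of the Kida–Pelz Galerkin evolution -/

/-- **`dZ_S/dt (0) = -(363/4)ν` from the Kida–Pelz datum** (`-2ν·11·(33/8)`; `0` for truncated
Euler), along any unforced Galerkin solution on a mode set containing the 24 modes. [folklore] -/
theorem hasDerivAt_truncEnstrophy_kp {U : ℝ → FourierVelocity} {S : Finset (Fin 3 → ℤ)} {ν : ℝ}
    {c : ℝ → (Fin 3 → ℤ) → ℂ} (hU : IsGalerkinSolution U S ν c fun _ _ _ => 0) (h0 : U 0 = kp)
    (hS : modes ⊆ S) :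
    HasDerivAt (fun s => truncEnstrophy (U s) S) (-(363 / 4) * ν) 0 := by
  have h := hasDerivAt_truncEnstrophy_singleShell hU 0 (lam := 11) (by rw [h0]; exact kp_isSingleShell)
  rw [h0, truncEnstrophy_kp_of_subset hS] at h
  convert h using 1
  ring

/-- The truncated-Euler case: the Kida–Pelz enstrophy curve starts flat. [folklore] -/
theorem hasDerivAt_truncEnstrophy_kp_euler {U : ℝ → FourierVelocity} {S : Finset (Fin 3 → ℤ)}
    {c : ℝ → (Fin 3 → ℤ) → ℂ} (hU : IsGalerkinSolution U S 0 c fun _ _ _ => 0) (h0 : U 0 = kp)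
    (hS : modes ⊆ S) :
    HasDerivAt (fun s => truncEnstrophy (U s) S) 0 0 := by
  simpa using hasDerivAt_truncEnstrophy_kp hU h0 hS

/-- and `dE_S/dt (0) = -2ν Z_S(0) = -(33/4)ν`. [folklore] -/
theorem hasDerivAt_truncEnergy_kp {U : ℝ → FourierVelocity} {S : Finset (Fin 3 → ℤ)} {ν : ℝ}
    {c : ℝ → (Fin 3 → ℤ) → ℂ} (hU : IsGalerkinSolution U S ν c fun _ _ _ => 0) (h0 : U 0 = kp)
    (hS : modes ⊆ S) :
    HasDerivAt (fun s => truncEnergy (U s) S) (-(33 / 4) * ν) 0 := by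
  have h := hasDerivAt_truncEnergy_galerkin hU 0
  rw [injectionRate_zero, add_zero, h0, truncEnstrophy_kp_of_subset hS] at h
  convert h using 1
  ring

end KidaPelzHat

/-! ## ABC: the six modes `±e₁, ±e₂, ±e₃`, `|k|² = 1`, Beltrami IN FOURIER SPACE (`curl û = û`)

`u = (A sin z + C cos y, B sin x + A cos z, C sin y + B cos x)` [cite: Frisch1995Turbulence, eq. (9.4)]
(as in `ABCFlowData`): `û(±e₃) = (∓iA/2, A/2, 0)`, `û(±e₁) = (0, ∓iB/2, B/2)`,
`û(±e₂) = (C/2, 0, ∓iC/2)`. Then `ik × û(k) = û(k)` mode by mode (`curl_abc`), so the helicity of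
every mode saturates the realizability bound of EnergyParseval v3 (`H(k) = 2|k|E(k)`, `|k| = 1`),
`H_S = 2E_S = A² + B² + C²` = ClassicalLatticeData/ABCFlowData's `cellHelicity`, and `Z_S = E_S`. -/

namespace ABCHat

open ABCFlow

variable (p : Coeffs)

/-- `e₁, e₂, e₃`. [folklore] -/
def e (i : Fin 3) : Fin 3 → ℤ := fun j => if j = i then 1 else 0

/-- The six ABC modes `{±e₁, ±e₂, ±e₃}` as three antipodal pairs. [folklore] -/
def M (i : Fin 3) : Finset (Fin 3 → ℤ) := {e i, -e i}

/-- `e i ≠ -e i`. [folklore] -/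
theorem e_ne_neg (i : Fin 3) : e i ≠ -e i := by
  intro h
  have := congrFun h i
  simp [e] at this

/-- The ABC Fourier coefficients. [folklore: Euler's formula applied to
[cite: Frisch1995Turbulence, eq. (9.4)]] -/
def coeffFun (k : Fin 3 → ℤ) (j : Fin 3) : ℂ :=
  if k = e 2 ∨ k = -e 2 then ![-I * (p.A : ℂ) * ((k 2 : ℤ) : ℂ) / 2, (p.A : ℂ) / 2, 0] j
  else if k = e 0 ∨ k = -e 0 then ![0, -I * (p.B : ℂ) * ((k 0 : ℤ) : ℂ) / 2, (p.B : ℂ) / 2] j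
  else if k = e 1 ∨ k = -e 1 then ![(p.C : ℂ) / 2, 0, -I * (p.C : ℂ) * ((k 1 : ℤ) : ℂ) / 2] j
  else 0

/-- The three pairs are the distinct. [folklore] -/
theorem ne_of_pairs :
    (e 0 ≠ e 2 ∧ e 0 ≠ -e 2 ∧ -e 0 ≠ e 2 ∧ -e 0 ≠ -e 2) ∧
    (e 1 ≠ e 2 ∧ e 1 ≠ -e 2 ∧ -e 1 ≠ e 2 ∧ -e 1 ≠ -e 2) ∧
    (e 1 ≠ e 0 ∧ e 1 ≠ -e 0 ∧ -e 1 ≠ e 0 ∧ -e 1 ≠ -e 0) := by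
  refine ⟨⟨?_, ?_, ?_, ?_⟩, ⟨?_, ?_, ?_, ?_⟩, ⟨?_, ?_, ?_, ?_⟩⟩ <;>
    · intro h; have := congrFun h 2; have h' := congrFun h 0; have h'' := congrFun h 1
      simp [e] at this h' h''

/-- Off the three antipodal pairs `±e₁, ±e₂, ±e₃`. [folklore] -/
def offModes (k : Fin 3 → ℤ) : Prop :=
  ¬ (k = e 2 ∨ k = -e 2) ∧ ¬ (k = e 0 ∨ k = -e 0) ∧ ¬ (k = e 1 ∨ k = -e 1)

/-- The six coefficient vectors. [folklore] -/
theorem coeffFun_e2 (j : Fin 3) : coeffFun p (e 2) j = ![-I * (p.A : ℂ) / 2, (p.A : ℂ) / 2, 0] j := by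
  unfold coeffFun; rw [if_pos (Or.inl rfl)]; simp [e]
/-- at `-e₃`. [folklore] -/
theorem coeffFun_neg_e2 (j : Fin 3) : coeffFun p (-e 2) j = ![I * (p.A : ℂ) / 2, (p.A : ℂ) / 2, 0] j := by
  unfold coeffFun; rw [if_pos (Or.inr rfl)]; simp [e]
/-- at `e₁`. [folklore] -/
theorem coeffFun_e0 (j : Fin 3) : coeffFun p (e 0) j = ![0, -I * (p.B : ℂ) / 2, (p.B : ℂ) / 2] j := by
  unfold coeffFun
  rw [if_neg (by decide), if_pos (Or.inl rfl)]; simp [e]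
/-- at `-e₁`. [folklore] -/
theorem coeffFun_neg_e0 (j : Fin 3) : coeffFun p (-e 0) j = ![0, I * (p.B : ℂ) / 2, (p.B : ℂ) / 2] j := by
  unfold coeffFun
  rw [if_neg (by decide), if_pos (Or.inr rfl)]; simp [e]
/-- at `e₂`. [folklore] -/
theorem coeffFun_e1 (j : Fin 3) : coeffFun p (e 1) j = ![(p.C : ℂ) / 2, 0, -I * (p.C : ℂ) / 2] j := by
  unfold coeffFun
  rw [if_neg (by decide), if_neg (by decide), if_pos (Or.inl rfl)]; simp [e]
/-- at `-e₂`. [folklore] -/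
theorem coeffFun_neg_e1 (j : Fin 3) : coeffFun p (-e 1) j = ![(p.C : ℂ) / 2, 0, I * (p.C : ℂ) / 2] j := by
  unfold coeffFun
  rw [if_neg (by decide), if_neg (by decide), if_pos (Or.inr rfl)]; simp [e]
/-- and zero elsewhere. [folklore] -/
theorem coeffFun_off {k : Fin 3 → ℤ} (h : offModes k) (j : Fin 3) : coeffFun p k j = 0 := by
  unfold coeffFun; rw [if_neg h.1, if_neg h.2.1, if_neg h.2.2]

/-- `offModes` is symmetric under `k ↦ -k`. [folklore] -/
theorem offModes_neg {k : Fin 3 → ℤ} (h : offModes k) : offModes (-k) := by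
  obtain ⟨h2, h0, h1⟩ := h
  refine ⟨?_, ?_, ?_⟩
  · rintro (hk | hk)
    · exact h2 (Or.inr (by rw [← hk, neg_neg]))
    · exact h2 (Or.inl (neg_inj.mp hk))
  · rintro (hk | hk)
    · exact h0 (Or.inr (by rw [← hk, neg_neg]))
    · exact h0 (Or.inl (neg_inj.mp hk))
  · rintro (hk | hk)
    · exact h1 (Or.inr (by rw [← hk, neg_neg]))
    · exact h1 (Or.inl (neg_inj.mp hk))

/-- Case split: a wavevector is one of the six modes or off them. [folklore] -/
theorem cases (k : Fin 3 → ℤ) :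
    k = e 2 ∨ k = -e 2 ∨ k = e 0 ∨ k = -e 0 ∨ k = e 1 ∨ k = -e 1 ∨ offModes k := by
  unfold offModes; tauto

/-- **The ABC datum as a `FourierVelocity`.** [folklore: Euler's formula applied to
[cite: Frisch1995Turbulence, eq. (9.4)]] -/
def abc : FourierVelocity where
  coeff := coeffFun p
  reality k i := by
    rcases cases k with rfl | rfl | rfl | rfl | rfl | rfl | hoff
    · rw [coeffFun_neg_e2, coeffFun_e2]
      fin_cases i <;> simp [map_mul, map_div₀, Complex.conj_I, Complex.conj_ofReal, map_ofNat]
    · rw [neg_neg, coeffFun_e2, coeffFun_neg_e2]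
      fin_cases i <;> simp [map_mul, map_div₀, Complex.conj_I, Complex.conj_ofReal, map_ofNat]
    · rw [coeffFun_neg_e0, coeffFun_e0]
      fin_cases i <;> simp [map_mul, map_div₀, Complex.conj_I, Complex.conj_ofReal, map_ofNat]
    · rw [neg_neg, coeffFun_e0, coeffFun_neg_e0]
      fin_cases i <;> simp [map_mul, map_div₀, Complex.conj_I, Complex.conj_ofReal, map_ofNat]
    · rw [coeffFun_neg_e1, coeffFun_e1]
      fin_cases i <;> simp [map_mul, map_div₀, Complex.conj_I, Complex.conj_ofReal, map_ofNat]
    · rw [neg_neg, coeffFun_e1, coeffFun_neg_e1]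
      fin_cases i <;> simp [map_mul, map_div₀, Complex.conj_I, Complex.conj_ofReal, map_ofNat]
    · rw [coeffFun_off p (offModes_neg hoff), coeffFun_off p hoff, map_zero]
  divFree k := by
    rw [Fin.sum_univ_three]
    rcases cases k with rfl | rfl | rfl | rfl | rfl | rfl | hoff
    · simp [coeffFun_e2, e]
    · simp [coeffFun_neg_e2, e]
    · simp [coeffFun_e0, e]
    · simp [coeffFun_neg_e0, e]
    · simp [coeffFun_e1, e]
    · simp [coeffFun_neg_e1, e]
    · simp [coeffFun_off p hoff]

/-- `abc.coeff = coeffFun`. [folklore] -/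
theorem abc_coeff (k : Fin 3 → ℤ) (j : Fin 3) : (abc p).coeff k j = coeffFun p k j := rfl

/-- The six ABC modes. [folklore] -/
def modes : Finset (Fin 3 → ℤ) := (M 2 ∪ M 0) ∪ M 1

/-- Membership in the six modes. [folklore] -/
theorem mem_modes {k : Fin 3 → ℤ} :
    k ∈ modes ↔ (k = e 2 ∨ k = -e 2) ∨ (k = e 0 ∨ k = -e 0) ∨ (k = e 1 ∨ k = -e 1) := by
  unfold modes M
  simp only [Finset.mem_union, Finset.mem_insert, Finset.mem_singleton]
  tauto

/-- Off the six modes ↔ `offModes`. [folklore] -/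
theorem offModes_of_not_mem {k : Fin 3 → ℤ} (h : k ∉ modes) : offModes k := by
  rw [mem_modes] at h
  unfold offModes; tauto

/-- The mode set is symmetric. [folklore] -/
theorem neg_mem_modes {k : Fin 3 → ℤ} (h : k ∈ modes) : -k ∈ modes := by
  rw [mem_modes] at h ⊢
  rcases h with (rfl | rfl) | (rfl | rfl) | (rfl | rfl) <;> simp

/-- Sums over the six modes. [folklore] -/
theorem sum_modes {N : Type*} [AddCommMonoid N] (g : (Fin 3 → ℤ) → N) :
    ∑ k ∈ modes, g k = (g (e 2) + g (-e 2)) + (g (e 0) + g (-e 0)) + (g (e 1) + g (-e 1)) := by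
  unfold modes
  have d20 : Disjoint (M 2) (M 0) := by
    unfold M; rw [Finset.disjoint_left]; intro k hk hk'
    simp only [Finset.mem_insert, Finset.mem_singleton] at hk hk'
    rcases hk with rfl | rfl <;> rcases hk' with h | h <;> exact absurd h (by decide)
  have d1 : Disjoint (M 2 ∪ M 0) (M 1) := by
    unfold M; rw [Finset.disjoint_left]; intro k hk hk'
    simp only [Finset.mem_union, Finset.mem_insert, Finset.mem_singleton] at hk hk'
    rcases hk with (rfl | rfl) | (rfl | rfl) <;> rcases hk' with h | h <;> exact absurd h (by decide)
  rw [Finset.sum_union d1, Finset.sum_union d20]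
  unfold M
  rw [Finset.sum_pair (e_ne_neg 2), Finset.sum_pair (e_ne_neg 0), Finset.sum_pair (e_ne_neg 1)]

/-- The plane waves of the six modes are single 1D modes. [folklore] -/
theorem wave_e0 (x y z : ℝ) : wave (e 0) x y z = mode 1 x := by simp [wave, e, mode_zero]
/-- `e^{i(-e₁)·x} = e_{-1}(x)`. [folklore] -/
theorem wave_neg_e0 (x y z : ℝ) : wave (-e 0) x y z = mode (-1) x := by simp [wave, e, mode_zero]
/-- `e^{i e₂·x} = e_1(y)`. [folklore] -/
theorem wave_e1 (x y z : ℝ) : wave (e 1) x y z = mode 1 y := by simp [wave, e, mode_zero]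
/-- `e^{i(-e₂)·x} = e_{-1}(y)`. [folklore] -/
theorem wave_neg_e1 (x y z : ℝ) : wave (-e 1) x y z = mode (-1) y := by simp [wave, e, mode_zero]
/-- `e^{i e₃·x} = e_1(z)`. [folklore] -/
theorem wave_e2 (x y z : ℝ) : wave (e 2) x y z = mode 1 z := by simp [wave, e, mode_zero]
/-- `e^{i(-e₃)·x} = e_{-1}(z)`. [folklore] -/
theorem wave_neg_e2 (x y z : ℝ) : wave (-e 2) x y z = mode (-1) z := by simp [wave, e, mode_zero]

/-! ### The trigonometric polynomial of `abc` is the ABC closed form -/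

/-- `u`: `Σ_k û₀(k) e^{ik·x} = A sin z + C cos y`. [folklore] -/
theorem field_eq_u (x y z : ℝ) : field (abc p) modes 0 x y z = ((ABCFlow.u p x y z : ℝ) : ℂ) := by
  unfold field
  rw [ABCFlow.u_eq, sum_modes]
  simp only [abc_coeff, coeffFun_e2, coeffFun_neg_e2, coeffFun_e0, coeffFun_neg_e0, coeffFun_e1,
    coeffFun_neg_e1, wave_e0, wave_neg_e0, wave_e1, wave_neg_e1, wave_e2, wave_neg_e2,
    Matrix.cons_val_zero, Complex.ofReal_add, Complex.ofReal_mul]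
  rw [ofReal_sin_eq_mode, ofReal_cos_eq_mode]
  ring

/-- `v`: `Σ_k û₁(k) e^{ik·x} = B sin x + A cos z`. [folklore] -/
theorem field_eq_v (x y z : ℝ) : field (abc p) modes 1 x y z = ((ABCFlow.v p x y z : ℝ) : ℂ) := by
  unfold field
  rw [ABCFlow.v_eq, sum_modes]
  simp only [abc_coeff, coeffFun_e2, coeffFun_neg_e2, coeffFun_e0, coeffFun_neg_e0, coeffFun_e1,
    coeffFun_neg_e1, wave_e0, wave_neg_e0, wave_e1, wave_neg_e1, wave_e2, wave_neg_e2,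
    Matrix.cons_val_one, Matrix.cons_val_zero, Complex.ofReal_add, Complex.ofReal_mul]
  rw [ofReal_sin_eq_mode, ofReal_cos_eq_mode]
  ring

/-- `w`: `Σ_k û₂(k) e^{ik·x} = C sin y + B cos x`. [folklore] -/
theorem field_eq_w (x y z : ℝ) : field (abc p) modes 2 x y z = ((ABCFlow.w p x y z : ℝ) : ℂ) := by
  unfold field
  rw [ABCFlow.w_eq, sum_modes]
  simp only [abc_coeff, coeffFun_e2, coeffFun_neg_e2, coeffFun_e0, coeffFun_neg_e0, coeffFun_e1,
    coeffFun_neg_e1, wave_e0, wave_neg_e0, wave_e1, wave_neg_e1, wave_e2, wave_neg_e2,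
    Matrix.cons_val_two, Matrix.tail_cons, Matrix.head_cons, Complex.ofReal_add, Complex.ofReal_mul]
  rw [ofReal_sin_eq_mode, ofReal_cos_eq_mode]
  ring

/-! ### Beltrami in Fourier space: `ik × û(k) = û(k)` -/

/-- `k × 0 = 0`. [folklore] -/
theorem kcross_zero_vec (k : Fin 3 → ℤ) (j : Fin 3) : kcross k (fun _ => (0 : ℂ)) j = 0 := by
  fin_cases j <;> simp [kcross]

/-- **`curl û = û` for the ABC datum** (coefficientwise): every ABC mode is a Beltrami mode with
`|k| = 1`. [folklore] -/
theorem curl_abc_coeff (k : Fin 3 → ℤ) (j : Fin 3) : (curl (abc p)).coeff k j = (abc p).coeff k j := by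
  rw [curl_coeff, abc_coeff]
  have hU : (abc p).coeff k = coeffFun p k := rfl
  rw [hU]
  rcases cases k with rfl | rfl | rfl | rfl | rfl | rfl | hoff
  · have hc : coeffFun p (e 2) = ![-I * (p.A : ℂ) / 2, (p.A : ℂ) / 2, 0] := funext (coeffFun_e2 p)
    rw [hc]; fin_cases j <;> simp [kcross, e, Complex.ext_iff] <;> ring
  · have hc : coeffFun p (-e 2) = ![I * (p.A : ℂ) / 2, (p.A : ℂ) / 2, 0] := funext (coeffFun_neg_e2 p)
    rw [hc]; fin_cases j <;> simp [kcross, e, Complex.ext_iff]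
  · have hc : coeffFun p (e 0) = ![0, -I * (p.B : ℂ) / 2, (p.B : ℂ) / 2] := funext (coeffFun_e0 p)
    rw [hc]; fin_cases j <;> simp [kcross, e, Complex.ext_iff] <;> ring
  · have hc : coeffFun p (-e 0) = ![0, I * (p.B : ℂ) / 2, (p.B : ℂ) / 2] := funext (coeffFun_neg_e0 p)
    rw [hc]; fin_cases j <;> simp [kcross, e, Complex.ext_iff]
  · have hc : coeffFun p (e 1) = ![(p.C : ℂ) / 2, 0, -I * (p.C : ℂ) / 2] := funext (coeffFun_e1 p)
    rw [hc]; fin_cases j <;> simp [kcross, e, Complex.ext_iff] <;> ring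
  · have hc : coeffFun p (-e 1) = ![(p.C : ℂ) / 2, 0, I * (p.C : ℂ) / 2] := funext (coeffFun_neg_e1 p)
    rw [hc]; fin_cases j <;> simp [kcross, e, Complex.ext_iff]
  · have hc : coeffFun p k = fun _ => (0 : ℂ) := funext (coeffFun_off p hoff)
    rw [hc, kcross_zero_vec, mul_zero]

/-- Hence mode by mode the helicity is twice the energy: `H(k) = 2E(k)` (the realizability bound of
EnergyParseval v3 ATTAINED, `|k| = 1`). [folklore] -/
theorem modalHelicity_abc (k : Fin 3 → ℤ) : modalHelicity (abc p) k = 2 * modalEnergy (abc p) k := by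
  unfold modalHelicity modalEnergy
  simp_rw [curl_abc_coeff]
  rw [Complex.re_sum]
  have h : ∀ j, ((abc p).coeff k j * conj ((abc p).coeff k j)).re = Complex.normSq ((abc p).coeff k j) :=
    fun j => by rw [Complex.mul_conj, Complex.ofReal_re]
  simp_rw [h]
  ring

/-! ### Single shell `|k|² = 1`, `E_S = (A²+B²+C²)/2`, `Z_S = E_S`, `H_S = 2E_S` -/

/-- Every carried mode has `|k|² = 1`. [folklore] -/
theorem abc_isSingleShell : IsSingleShell (abc p) 1 := by
  intro k hk
  rcases cases k with rfl | rfl | rfl | rfl | rfl | rfl | hoff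
  all_goals first
    | (unfold knormSq; rw [Fin.sum_univ_three]; simp [e])
    | exact absurd (funext fun j => coeffFun_off p hoff j) hk

/-- **`E_S = (A² + B² + C²)/2`** (`= 3/2` for the cell's `A = B = C = 1`). [folklore] -/
theorem truncEnergy_abc : truncEnergy (abc p) modes = (p.A ^ 2 + p.B ^ 2 + p.C ^ 2) / 2 := by
  unfold truncEnergy
  rw [sum_modes]
  unfold modalEnergy
  simp only [Fin.sum_univ_three, abc_coeff, coeffFun_e2, coeffFun_neg_e2, coeffFun_e0, coeffFun_neg_e0,
    coeffFun_e1, coeffFun_neg_e1, Matrix.cons_val_zero, Matrix.cons_val_one, Matrix.head_cons,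
    Matrix.cons_val_two, Matrix.tail_cons, map_zero, Complex.normSq_div, Complex.normSq_mul,
    Complex.normSq_neg, Complex.normSq_I, Complex.normSq_ofReal]
  have e2 : Complex.normSq (2 : ℂ) = 4 := by
    rw [show (2 : ℂ) = ((2 : ℝ) : ℂ) by norm_num, Complex.normSq_ofReal]; norm_num
  rw [e2]
  ring

/-- `Z_S = E_S` (single shell `|k|² = 1`). [folklore] -/
theorem truncEnstrophy_abc : truncEnstrophy (abc p) modes = truncEnergy (abc p) modes := by
  rw [truncEnstrophy_eq_of_singleShell (abc p) modes (abc_isSingleShell p), one_mul]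

/-- **`H_S = 2E_S = A² + B² + C²`** (maximal helicity). [folklore] -/
theorem truncHelicity_abc : truncHelicity (abc p) modes = p.A ^ 2 + p.B ^ 2 + p.C ^ 2 := by
  unfold truncHelicity
  simp_rw [modalHelicity_abc]
  rw [← Finset.mul_sum]
  change 2 * truncEnergy (abc p) modes = _
  rw [truncEnergy_abc]
  ring

/-- **Parseval cross-checks** with ABCFlowData's iterated-integral values. [folklore] -/
theorem truncEnergy_abc_eq_cellEnergy :
    truncEnergy (abc p) modes = cellEnergy (ABCFlow.u p) (ABCFlow.v p) (ABCFlow.w p) := by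
  rw [← cellEnergy_field_eq_truncEnergy (abc p) modes fun k hk => neg_mem_modes hk]
  congr 1 <;> funext x y z
  · rw [field_eq_u, Complex.ofReal_re]
  · rw [field_eq_v, Complex.ofReal_re]
  · rw [field_eq_w, Complex.ofReal_re]

/-- The spectral helicity equals ABCFlowData's `cellHelicity = ⟨u·ω⟩`. [folklore] -/
theorem truncHelicity_abc_eq_cellHelicity :
    truncHelicity (abc p) modes = cellHelicity (ABCFlow.u p) (ABCFlow.v p) (ABCFlow.w p) := by
  rw [← cellHelicity_field_eq_truncHelicity (abc p) modes fun k hk => neg_mem_modes hk]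
  congr 1 <;> funext x y z
  · rw [field_eq_u, Complex.ofReal_re]
  · rw [field_eq_v, Complex.ofReal_re]
  · rw [field_eq_w, Complex.ofReal_re]

/-- The realizability bound of EnergyParseval v3 is an EQUALITY on every ABC mode. [folklore] -/
theorem modalHelicity_abc_eq_bound (k : Fin 3 → ℤ) :
    modalHelicity (abc p) k = 2 * Real.sqrt (knormSq k) * modalEnergy (abc p) k := by
  rw [modalHelicity_abc]
  by_cases hk : (abc p).coeff k = 0
  · rw [modalEnergy_eq_zero_of_coeff (abc p) hk]; ring
  · rw [abc_isSingleShell p k hk, Real.sqrt_one]; ring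

/-- Initial slopes along any unforced Galerkin solution from the ABC datum on `S ⊇ modes`:
`dE_S/dt (0) = -2ν E_S(0)` (the exact decay of ABCFlowData, seen in the truncated system) and
`dZ_S/dt (0) = -2ν Z_S(0)`. [folklore] -/
theorem hasDerivAt_truncEnstrophy_abc {U : ℝ → FourierVelocity} {S : Finset (Fin 3 → ℤ)} {ν : ℝ}
    {c : ℝ → (Fin 3 → ℤ) → ℂ} (hU : IsGalerkinSolution U S ν c fun _ _ _ => 0) (h0 : U 0 = abc p) :
    HasDerivAt (fun s => truncEnstrophy (U s) S) (-(2 * ν) * truncEnstrophy (abc p) S) 0 := by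
  have h := hasDerivAt_truncEnstrophy_singleShell hU 0 (lam := 1) (by rw [h0]; exact abc_isSingleShell p)
  rw [h0] at h
  convert h using 1
  ring

end ABCHat

end ShellTransfer

end Literature.Analysis.FluidPDE.FluidComputer

end
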